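import Summits.CriticalPhenomena.SAWScalingLimit.Theses.SAWRestrictionRigidity
import Summits.CriticalPhenomena.SAWScalingLimit.Theses.SAWLoopFugacityFlow
import Summits.CriticalPhenomena.SAWScalingLimit.Theorems.SubseqIdentification.Negative.Necessity
import Summits.CriticalPhenomena.SAWScalingLimit.Theorems.SubseqIdentification.Negative.ProbabilityRedundant
import Summits.CriticalPhenomena.SAWScalingLimit.Theorems.SAWRestrictionRigidityLimitExistsStubInterleave
import Summits.CriticalPhenomena.SAWScalingLimit.Theorems.SAWRestrictionRigidityLimitExistsStubPortmanteau
import Summits.CriticalPhenomena.SAWScalingLimit.Theorems.SAWRestrictionRigidityLimitExistsStubAvoidanceSandwich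
import Literature.Probability.RandomPlanarGeometry.SLEConvergenceCriterion
import Literature.Probability.RandomPlanarGeometry.SAWScalingLimitFamily
import HarnessLib

/-!
# `LimitExists` (crux stmt-CriticalPhenomena-1371) modulo the three existing lattice items
`EventualTight` (stmt-1372), `SimpleSubseqLimits` (stmt-4982), `AvoidanceCocycleLimit` (stmt-1369)

Route `SAWRestrictionRigidity` of `CriticalPhenomena/SAWScalingLimit` (crux shared verbatim by
SAWGaussianRotation, SAWInfinitesimalRigidity, SAWPoissonBanks, SAWExpCovariance, SAWConePseudogroup,
SAWRestrictionDescent, SAWPtolemyBoundary); line `registered` (`Cruxes/LimitExists/Lines/birth.lean`, lead c1).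
This file is the sorry-free part of the line's skeleton v3, i.e. everything but the three open lattice
inputs, which enter as hypotheses BY NAME (route items):

* `exists_subseqLimit` — Prokhorov past the junk meshes: under eventual tightness every mesh sequence
  `sₙ → 0⁺` has a subsequence along which the pushed-forward critical SAW laws converge weakly to a
  probability measure (`IsTightAlongMesh.exists_subseq` on the surrogate family "law if probability, else
  a Dirac mass", equal to the laws on a germ at `0⁺` by `eventually_isProbabilityMeasure_law`).
* `avoidanceAgreement_of_items` — two subsequential limits of one Dobrushin domain (any two endpoint
  approximations, any two mesh sequences) give the same mass to `{range ⊆ cl D'}` for every hull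
  subdomain `D'`, from (S) `SimpleSubseqLimits` + (C) `AvoidanceCocycleLimit` and the landed glue
  `stub_interleave` (approximation-freeness of full-filter limits), `stub_portmanteau` (closed/open
  portmanteau past the junk meshes), `stub_avoidanceSandwich` (carved hull super-domains,
  `AvoidancePassage.exists_superdomain`).
* `exists_isScalingLimitFamily_of_items` / **`LimitExists_of_items : EventualTight → SimpleSubseqLimits →
  AvoidanceCocycleLimit → LimitExists`** — Billingsley's subsequence principle along the countably
  generated filter `𝓝[>] 0`: reference subsequential limit `P D` by (T); uniqueness of every
  subsequential limit by the route's PROVED engine `AvoidanceDeterminesLaw_holds` (stmt-1373) fed with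
  (S), (S) and the avoidance agreement; chordality by `ae_endpoints_of_hyps`,
  `ae_range_subset_closure_of_hyps`; `Filter.tendsto_of_subseq_tendsto` concludes.

CONDITIONAL result: the three hypotheses are open items of the ledger (1372 support of this route; 4982
crux of SAWLoopFugacityFlow; 1369 crux r3 of this route, itself implied by SAWLoopFugacityFlow's
`AvoidanceLimit`, stmt-10649, via `avoidanceCocycleLimit_of_avoidanceLimit`,
`Theorems/SAWRestrictionRigidityLimitExistsCocycleOfAvoidanceLimit.lean`).  Nothing else is assumed.
-/

noncomputable section

open MeasureTheory Filter Topology Set Metric Function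
open Literature.Probability.RandomPlanarGeometry Literature.Probability.RandomPlanarGeometry.SAW
open Literature.Probability.LatticeModels
open scoped ENNReal NNReal BoundedContinuousFunction MeasureTheory Topology ProbabilityTheory

namespace Summit.CriticalPhenomena.SAWScalingLimit.Theorems.SAWRestrictionRigidityLimitExists

open Summit.CriticalPhenomena.SAWScalingLimit.Theses.SAWRestrictionRigidity
  (LimitExists EventualTight AvoidanceCocycleLimit AvoidanceDeterminesLaw AvoidanceDeterminesLaw_holds)
open Summit.CriticalPhenomena.SAWScalingLimit.Theses.SAWLoopFugacityFlow (SimpleSubseqLimits)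
open Summit.CriticalPhenomena.SAWScalingLimit.Theorems.SubseqIdentification.Negative
  (eventually_isProbabilityMeasure_law ae_endpoints_of_hyps ae_range_subset_closure_of_hyps)

/-! ## Prokhorov past the junk meshes -/

/-- **Subsequential limits exist under eventual tightness.**  If the pushed-forward critical SAW laws
are a tight set for `δ ∈ (0, δ₀]`, then along every mesh sequence `sₙ → 0⁺` some subsequence converges
weakly (bounded continuous test functions of `γ.curve`) to a probability measure.  The SAW law is a
probability measure only for small `δ` (junk value `0` when `a_δ, b_δ` are not joined), so Prokhorov
(`IsTightAlongMesh.exists_subseq`) is run on the surrogate family "push-forward law if it is a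
probability measure, else a Dirac mass", which agrees with the push-forward laws on a germ at `0⁺`
(`eventually_isProbabilityMeasure_law`). [cite: BillingsleyCPM1999, Thm. 5.1] -/
theorem exists_subseqLimit {D : DobrushinDomain} {a b : ℝ → Site 2} (hab : SAW.IsEndpointApprox D a b)
    {δ₀ : ℝ} (hδ₀ : 0 < δ₀)
    (htight : IsTightMeasureSet ((fun δ => (SAW.law D.carrier δ (a δ) (b δ)).map
      (fun γ => γ.curve)) '' Set.Ioc 0 δ₀))
    {s : ℕ → ℝ} (hs : Tendsto s atTop (𝓝[>] (0 : ℝ))) :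
    ∃ (φ : ℕ → ℕ) (ν : Measure (CurveClass ℂ)), StrictMono φ ∧ IsProbabilityMeasure ν ∧
      ∀ f : CurveClass ℂ →ᵇ ℝ, Tendsto (fun n => ∫ γ, f γ.curve
        ∂(SAW.law D.carrier (s (φ n)) (a (s (φ n))) (b (s (φ n))))) atTop (𝓝 (∫ x, f x ∂ν)) := by
  classical
  -- the push-forward laws and the surrogate family of probability laws on the curve space
  obtain ⟨L, hL⟩ : ∃ L : ℝ → Measure (CurveClass ℂ), ∀ δ, L δ =
      (SAW.law D.carrier δ (a δ) (b δ)).map (fun γ => γ.curve) := ⟨_, fun _ => rfl⟩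
  obtain ⟨μ, hμ⟩ : ∃ μ : ℝ → Measure (CurveClass ℂ), ∀ δ, μ δ =
      if IsProbabilityMeasure (L δ) then L δ
      else Measure.dirac (CurveClass.mk (Curve.const 0)) := ⟨_, fun _ => rfl⟩
  have hμprob : ∀ δ, IsProbabilityMeasure (μ δ) := by
    intro δ
    by_cases h : IsProbabilityMeasure (L δ)
    · rw [hμ δ, if_pos h]; exact h
    · rw [hμ δ, if_neg h]; infer_instance
  -- for all small `δ` the surrogate IS the push-forward law
  have hev : ∀ᶠ δ in 𝓝[>] (0 : ℝ), μ δ = L δ := by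
    filter_upwards [eventually_isProbabilityMeasure_law hab] with δ hδ
    haveI := hδ
    have hp : IsProbabilityMeasure (L δ) := by
      rw [hL δ]
      exact Measure.isProbabilityMeasure_map (SAW.aemeasurable_curve _ _ _ _)
    rw [hμ δ, if_pos hp]
  -- tightness along the mesh of the surrogate family, observed through the identity
  have hT : IsTightAlongMesh (Ωδ := fun _ : ℝ => CurveClass ℂ)
      (fun (_ : ℝ) (x : CurveClass ℂ) => x) μ := by
    intro ε hε
    obtain ⟨K, hK, hbK⟩ :=
      (isTightMeasureSet_iff_exists_isCompact_measure_compl_le.1 htight) ε hε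
    refine ⟨K, hK, ?_⟩
    filter_upwards [hev, Ioc_mem_nhdsGT hδ₀] with δ hδ hδI
    show μ δ Kᶜ ≤ ε
    rw [hδ, hL δ]
    exact hbK _ ⟨δ, hδI, rfl⟩
  haveI : ∀ δ, IsProbabilityMeasure (μ δ) := hμprob
  obtain ⟨φ, ν, hφ, hν, hlim⟩ :=
    hT.exists_subseq (Filter.Eventually.of_forall fun δ => aemeasurable_id') hs
  refine ⟨φ, ν, hφ, hν, fun f => ?_⟩
  have hs' : Tendsto (fun n => s (φ n)) atTop (𝓝[>] (0 : ℝ)) := hs.comp hφ.tendsto_atTop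
  refine (hlim f).congr' ?_
  filter_upwards [hs'.eventually hev] with n hn
  have hn' : μ (s (φ n)) = L (s (φ n)) := hn
  show ∫ x, f x ∂(μ (s (φ n))) = ∫ γ, f γ.curve ∂(SAW.law D.carrier (s (φ n)) (a (s (φ n))) (b (s (φ n))))
  rw [hn', hL]
  exact integral_map (SAW.aemeasurable_curve _ _ _ _) f.continuous.aestronglyMeasurable

/-! ## Avoidance agreement of two subsequential limits -/

/-- **Avoidance agreement of two subsequential limits** (from the items (S) and (C)).  For one Dobrushin
domain `D`, two endpoint approximations, two mesh sequences `s, s' → 0⁺` and two probability weak limits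
`ν, ν'` of the corresponding pushed-forward critical SAW laws, `ν(range ⊆ cl D') = ν'(range ⊆ cl D')` for
every hull subdomain `D'` (Dobrushin, `D' ⊆ D`, same marked points, agreeing with `D` near them).  For each
hull super-domain `E`: (C) gives the full-filter limits `c_E`, `c'_E` of the avoidance probability along
the two approximations, interleaving (`stub_interleave`) gives `c_E = c'_E`, the closed half of the
portmanteau (`stub_portmanteau`) gives `c'_E ≤ ν'(range ⊆ cl E)`; then the sandwich
(`stub_avoidanceSandwich`, fed with the open half for `ν` and the carrier of `ν'` from (S)) gives `ν ≤ ν'`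
on the event, and symmetrically. [folklore] -/
theorem avoidanceAgreement_of_items (hS : SimpleSubseqLimits) (hC : AvoidanceCocycleLimit) :
    ∀ (D : DobrushinDomain) (a b a' b' : ℝ → Site 2), SAW.IsEndpointApprox D a b →
      SAW.IsEndpointApprox D a' b' → ∀ (s s' : ℕ → ℝ) (ν ν' : Measure (CurveClass ℂ)),
      Tendsto s atTop (𝓝[>] (0 : ℝ)) → Tendsto s' atTop (𝓝[>] (0 : ℝ)) →
      IsProbabilityMeasure ν → IsProbabilityMeasure ν' →
      (∀ f : CurveClass ℂ →ᵇ ℝ, Tendsto (fun n => ∫ γ, f γ.curve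
        ∂(SAW.law D.carrier (s n) (a (s n)) (b (s n)))) atTop (𝓝 (∫ x, f x ∂ν))) →
      (∀ f : CurveClass ℂ →ᵇ ℝ, Tendsto (fun n => ∫ γ, f γ.curve
        ∂(SAW.law D.carrier (s' n) (a' (s' n)) (b' (s' n)))) atTop (𝓝 (∫ x, f x ∂ν'))) →
      ∀ D' : DobrushinDomain, D'.carrier ⊆ D.carrier → D'.pt 0 = D.pt 0 → D'.pt 1 = D.pt 1 →
      (∃ ε : ℝ, 0 < ε ∧ D'.carrier ∩ ball (D.pt 0) ε = D.carrier ∩ ball (D.pt 0) ε ∧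
        D'.carrier ∩ ball (D.pt 1) ε = D.carrier ∩ ball (D.pt 1) ε) →
      ν (CurveClass.rangeSubset (closure D'.carrier)) =
        ν' (CurveClass.rangeSubset (closure D'.carrier)) := by
  intro D a b a' b' hab hab' s s' ν ν' hs hs' hν hν' hlim hlim' D' hsub h0 h1 _
  -- one-sided comparison for an ordered pair of subsequential limits of `D`
  have key : ∀ {a b a' b' : ℝ → Site 2} {s s' : ℕ → ℝ} {ν ν' : Measure (CurveClass ℂ)},
      SAW.IsEndpointApprox D a b → SAW.IsEndpointApprox D a' b' →
      Tendsto s atTop (𝓝[>] (0 : ℝ)) → Tendsto s' atTop (𝓝[>] (0 : ℝ)) →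
      IsProbabilityMeasure ν → IsProbabilityMeasure ν' →
      (∀ f : CurveClass ℂ →ᵇ ℝ, Tendsto (fun n => ∫ γ, f γ.curve
        ∂(SAW.law D.carrier (s n) (a (s n)) (b (s n)))) atTop (𝓝 (∫ x, f x ∂ν))) →
      (∀ f : CurveClass ℂ →ᵇ ℝ, Tendsto (fun n => ∫ γ, f γ.curve
        ∂(SAW.law D.carrier (s' n) (a' (s' n)) (b' (s' n)))) atTop (𝓝 (∫ x, f x ∂ν'))) →
      ν (CurveClass.rangeSubset (closure D'.carrier)) ≤
        ν' (CurveClass.rangeSubset (closure D'.carrier)) := by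
    intro a b a' b' s s' ν ν' hab hab' hs hs' hν hν' hlim hlim'
    refine stub_avoidanceSandwich D a b hab s ν ν' hs hν hν'
      (stub_portmanteau D.carrier a b s ν hν hlim).2 ?_ ?_ D' hsub h0 h1
    · -- the carrier of `ν'`, from (S)
      filter_upwards [hS D a' b' hab' s' ν' hs' hν' hlim'] with γ hγ
      exact ⟨hγ.2.2.2.1, hγ.2.2.2.2⟩
    · -- cocycle limits along `s`, bounded by `ν'` on every hull super-domain
      intro E hEsub hE0 hE1 hEε
      obtain ⟨c, hc⟩ := hC D E a b hab hEsub hE0 hE1 hEε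
      obtain ⟨c', hc'⟩ := hC D E a' b' hab' hEsub hE0 hE1 hEε
      have hcc' : c = c' :=
        stub_interleave D (fun δ x y => ((SAW.law D.carrier δ x y).map (fun γ => γ.curve))
            (CurveClass.rangeSubset (closure E.carrier)))
          (fun a'' b'' hab'' => hC D E a'' b'' hab'' hEsub hE0 hE1 hEε) a b a' b' c c' hab hab' hc hc'
      refine ⟨c, hc.comp hs, ?_⟩
      have hle := (stub_portmanteau D.carrier a' b' s' ν' hν' hlim').1
        (CurveClass.rangeSubset (closure E.carrier))
        (CurveClass.isClosed_rangeSubset isClosed_closure)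
      have hT' : Tendsto (fun n => ((SAW.law D.carrier (s' n) (a' (s' n)) (b' (s' n))).map
          (fun γ => γ.curve)) (CurveClass.rangeSubset (closure E.carrier))) atTop (𝓝 c') :=
        hc'.comp hs'
      rw [hT'.limsup_eq] at hle
      rwa [hcc']
  exact le_antisymm (key hab hab' hs hs' hν hν' hlim hlim') (key hab' hab hs' hs hν' hν hlim' hlim)

/-! ## The subsequence principle -/

/-- **A scaling-limit family of the critical SAW from the items (T), (S), (C)** (the body of `LimitExists`,
stated through `SAW.IsScalingLimitFamily`, `Iff.rfl`-equal).  For each Dobrushin domain `D` pick an endpoint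
approximation (`SAW.exists_isEndpointApprox`), the mesh sequence `1/(n+1)` and, by (T) +
`exists_subseqLimit`, a probability subsequential limit `P D`.  It is chordal (tree: `ae_endpoints_of_hyps`,
`ae_range_subset_closure_of_hyps`).  Every probability subsequential limit `ν` of `D` along ANY
approximation and sequence equals `P D`: both are carried by simple boundary-avoiding chords by (S) and
have the same hull-subdomain avoidance masses by `avoidanceAgreement_of_items`, so
`AvoidanceDeterminesLaw_holds` applies.  Then `Filter.tendsto_of_subseq_tendsto` along the countably
generated filter `𝓝[>] 0` gives `TendstoLaw`. [cite: BillingsleyCPM1999, Thm. 2.6 and Thm. 5.1 Corollary] -/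
theorem exists_isScalingLimitFamily_of_items (hT : EventualTight) (hS : SimpleSubseqLimits)
    (hC : AvoidanceCocycleLimit) : ∃ P : ChordalFamily, SAW.IsScalingLimitFamily P := by
  classical
  have hA := avoidanceAgreement_of_items hS hC
  -- the reference mesh sequence `1/(n+1) → 0⁺`
  have hs₁ : Tendsto (fun n : ℕ => 1 / ((n : ℝ) + 1)) atTop (𝓝[>] (0 : ℝ)) :=
    tendsto_nhdsWithin_iff.2 ⟨tendsto_one_div_add_atTop_nhds_zero_nat,
      Filter.Eventually.of_forall fun n => Set.mem_Ioi.2 Nat.one_div_pos_of_nat⟩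
  -- per domain: a reference approximation, sequence and probability subsequential limit
  have key : ∀ D : DobrushinDomain, ∃ (a b : ℝ → Site 2) (s : ℕ → ℝ) (ν : Measure (CurveClass ℂ)),
      SAW.IsEndpointApprox D a b ∧ Tendsto s atTop (𝓝[>] (0 : ℝ)) ∧ IsProbabilityMeasure ν ∧
      ∀ f : CurveClass ℂ →ᵇ ℝ, Tendsto (fun n => ∫ γ, f γ.curve
        ∂(SAW.law D.carrier (s n) (a (s n)) (b (s n)))) atTop (𝓝 (∫ x, f x ∂ν)) := by
    intro D
    obtain ⟨a, b, hab⟩ := SAW.exists_isEndpointApprox D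
    obtain ⟨δ₀, hδ₀, htight⟩ := hT D a b hab
    obtain ⟨φ, ν, hφ, hν, hlim⟩ := exists_subseqLimit hab hδ₀ htight hs₁
    exact ⟨a, b, fun n => 1 / (((φ n : ℕ) : ℝ) + 1), ν, hab, hs₁.comp hφ.tendsto_atTop, hν, hlim⟩
  choose a₀ b₀ s₀ P hab₀ hs₀ hP hlim₀ using key
  -- uniqueness of subsequential limits: (S), (S), (A) feed `AvoidanceDeterminesLaw_holds`
  have huniq : ∀ (D : DobrushinDomain) (a b : ℝ → Site 2), SAW.IsEndpointApprox D a b →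
      ∀ (s : ℕ → ℝ) (ν : Measure (CurveClass ℂ)), Tendsto s atTop (𝓝[>] (0 : ℝ)) →
      IsProbabilityMeasure ν →
      (∀ f : CurveClass ℂ →ᵇ ℝ, Tendsto (fun n => ∫ γ, f γ.curve
        ∂(SAW.law D.carrier (s n) (a (s n)) (b (s n)))) atTop (𝓝 (∫ x, f x ∂ν))) → ν = P D := by
    intro D a b hab s ν hs hν hlim
    exact AvoidanceDeterminesLaw_holds D ν (P D) hν (hP D) (hS D a b hab s ν hs hν hlim)
      (hS D (a₀ D) (b₀ D) (hab₀ D) (s₀ D) (P D) (hs₀ D) (hP D) (hlim₀ D))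
      (fun D' hsub h0 h1 hε => hA D a b (a₀ D) (b₀ D) hab (hab₀ D) s (s₀ D) ν (P D) hs (hs₀ D)
        hν (hP D) hlim (hlim₀ D) D' hsub h0 h1 hε)
  refine ⟨P, fun D => ⟨hP D, ?_⟩, fun D a b hab f => ?_⟩
  · -- chordal: endpoints and confinement of the reference subsequential limit (tree lemmas)
    haveI := hP D
    filter_upwards [ae_endpoints_of_hyps (hab₀ D) (hs₀ D) (hlim₀ D),
      ae_range_subset_closure_of_hyps (hab₀ D) (hs₀ D) (hlim₀ D)] with γ h1 h2
    exact ⟨h1.1, h1.2, h2⟩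
  · -- convergence along the full filter `𝓝[>] 0`: the subsequence principle
    refine tendsto_of_subseq_tendsto fun ns hns => ?_
    obtain ⟨δ₀, hδ₀, htight⟩ := hT D a b hab
    obtain ⟨φ, ν, hφ, hν, hlim⟩ := exists_subseqLimit hab hδ₀ htight hns
    have hν' : ν = P D :=
      huniq D a b hab (fun n => ns (φ n)) ν (hns.comp hφ.tendsto_atTop) hν hlim
    refine ⟨φ, ?_⟩
    have h := hlim f
    rw [hν'] at h
    simpa only [id_eq] using h

/-- **`LimitExists` modulo the three existing lattice items** (T) `EventualTight` (stmt-1372), (S)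
`SimpleSubseqLimits` (stmt-4982), (C) `AvoidanceCocycleLimit` (stmt-1369): the full scaling limit of the
critical `δℤ²` SAW laws exists as a chordal curve family as soon as the laws are eventually tight, their
subsequential limits are carried by simple boundary-avoiding chords, and the lattice avoidance
probabilities of hull subdomains converge along `δ → 0⁺`.  (`LimitExists ↔ ∃ P, SAW.IsScalingLimitFamily P`
by `Iff.rfl`.)  Registered sub-goal of the crux item stmt-CriticalPhenomena-1371.
[cite: BillingsleyCPM1999, Thm. 2.6] -/
theorem LimitExists_of_items : Summit.CriticalPhenomena.SAWScalingLimit.Theses.SAWRestrictionRigidity.EventualTight → Summit.CriticalPhenomena.SAWScalingLimit.Theses.SAWLoopFugacityFlow.SimpleSubseqLimits → Summit.CriticalPhenomena.SAWScalingLimit.Theses.SAWRestrictionRigidity.AvoidanceCocycleLimit → Summit.CriticalPhenomena.SAWScalingLimit.Theses.SAWRestrictionRigidity.LimitExists :=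
  fun hT hS hC => exists_isScalingLimitFamily_of_items hT hS hC

end Summit.CriticalPhenomena.SAWScalingLimit.Theorems.SAWRestrictionRigidityLimitExists
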